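import Mathlib
import Summits.Ventures.HodgeRepro2.Tier7.Target

/-!
# Tier7/Common/Shadow — the lemma layer over the Target's `SurfaceShadow` (t7-typer-1)

Cell pub-hodge-repro2, Tier 7 (README §11–§12), seat t7-typer-1 (sole filer of `Tier7/Common/**`).
Proof lane: every declaration below is PROVED from the fields of `SurfaceShadow HX G` as frozen in
`Tier7/Target.lean`; no new carrier, no new field, no axiom, no `sorry`. Nothing here asserts the step.

CONTENT. (1) A Hecke translate `g` as a ℂ-linear map `actLinear g` and as a ℂ-algebra automorphism
`actAlgEquiv g` (fields `act_add`, `act_mul`, `act_smul` + the group law), with `g • 0 = 0`, `g • 1 = 1`,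
`g • (-a)`, `g • (a - b)`, `g • ∑`; (2) complex conjugation `bar` as a conjugate-linear map `barSemilinear`
(`bar_zero`, `bar_one`, `bar_neg`, `bar_sub`, `bar_sum`, `bar_injective`); (3) the laws of the `L²` pairing
`L2 a b = ∫_X a ∧ b̄`: linear in the first slot, conjugate-linear in the second, Hecke-invariant (`L2_act`),
conjugate-symmetric and positive on holomorphic 2-forms (`L2_conj_symm`, `L2_self_ne_zero` — from `comm_H20`,
`intX_bar`, `hr_pos`), the positivity consequence `L2_ne_zero_of_eq_smul` (`b = c • a`, `c ≠ 0`, `0 ≠ a ∈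
H^{1,0} ∧ H^{1,0}` ⇒ `L2 a b ≠ 0`), non-degeneracy on `H^{1,0} ∧ H^{1,0}` and the `L²`-orthogonal complement
`orth`; (4) a (semi)linear functional non-zero on a span is non-zero on a generator. The Hecke spans and the
consequences of semisimplicity are in `Tier7/Common/Hecke.lean`.

§8(d): uses an L-value-free non-vanishing device: NO (general lemmas over the carriers).
-/

namespace Summit.Ventures.HodgeRepro2.Tier7

noncomputable section

namespace SurfaceShadow

variable {HX : Type} [Ring HX] [Algebra ℂ HX] {G : Type} [Group G] [MulAction G HX]

/-! ### 1. The Hecke translates as linear maps / algebra automorphisms -/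

/-- The Hecke translate `g` as a ℂ-linear map `H^*(X_∞, ℂ) → H^*(X_∞, ℂ)`. -/
def actLinear (S : SurfaceShadow HX G) (g : G) : HX →ₗ[ℂ] HX where
  toFun a := g • a
  map_add' := S.act_add g
  map_smul' c a := S.act_smul g c a

/-- `actLinear g a = g • a`. -/
@[simp] theorem actLinear_apply (S : SurfaceShadow HX G) (g : G) (a : HX) : S.actLinear g a = g • a := rfl

/-- `g • 0 = 0`. -/
theorem act_zero (S : SurfaceShadow HX G) (g : G) : g • (0 : HX) = 0 := (S.actLinear g).map_zero

/-- `g • (-a) = -(g • a)`. -/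
theorem act_neg (S : SurfaceShadow HX G) (g : G) (a : HX) : g • (-a) = -(g • a) := (S.actLinear g).map_neg a

/-- `g • (a - b) = g • a - g • b`. -/
theorem act_sub (S : SurfaceShadow HX G) (g : G) (a b : HX) : g • (a - b) = g • a - g • b := (S.actLinear g).map_sub a b

/-- A Hecke translate commutes with finite sums. -/
theorem act_sum (S : SurfaceShadow HX G) (g : G) {ι : Type*} (s : Finset ι) (f : ι → HX) :
    g • (∑ i ∈ s, f i) = ∑ i ∈ s, g • f i :=
  map_sum (S.actLinear g) f s

/-- `g • 1 = 1`: the unit is fixed by every Hecke translate (from `act_mul` and invertibility). -/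
theorem act_one (S : SurfaceShadow HX G) (g : G) : g • (1 : HX) = 1 := by
  have h : g • (g⁻¹ • (1 : HX)) = 1 := smul_inv_smul g 1
  calc g • (1 : HX) = 1 * g • (1 : HX) := (one_mul _).symm
    _ = g • (g⁻¹ • (1 : HX)) * g • (1 : HX) := by rw [h]
    _ = g • (g⁻¹ • (1 : HX) * 1) := by rw [S.act_mul]
    _ = g • (g⁻¹ • (1 : HX)) := by rw [mul_one]
    _ = 1 := h

/-- A Hecke translate fixes the scalars `algebraMap ℂ HX c`. -/
theorem act_algebraMap (S : SurfaceShadow HX G) (g : G) (c : ℂ) : g • (algebraMap ℂ HX c) = algebraMap ℂ HX c := by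
  rw [Algebra.algebraMap_eq_smul_one, S.act_smul, S.act_one]

/-- The Hecke translate `g` as a ℂ-algebra automorphism of `H^*(X_∞, ℂ)`. -/
def actAlgEquiv (S : SurfaceShadow HX G) (g : G) : HX ≃ₐ[ℂ] HX where
  toFun a := g • a
  invFun a := g⁻¹ • a
  left_inv a := inv_smul_smul g a
  right_inv a := smul_inv_smul g a
  map_mul' := S.act_mul g
  map_add' := S.act_add g
  commutes' c := S.act_algebraMap g c

/-- `actAlgEquiv g a = g • a`. -/
@[simp] theorem actAlgEquiv_apply (S : SurfaceShadow HX G) (g : G) (a : HX) : S.actAlgEquiv g a = g • a := rfl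

/-- `g • a = 0 ↔ a = 0` (a Hecke translate is invertible). -/
theorem act_eq_zero_iff (S : SurfaceShadow HX G) (g : G) (a : HX) : g • a = 0 ↔ a = 0 :=
  (S.actAlgEquiv g).map_eq_zero_iff

/-- `g • a ≠ 0 ↔ a ≠ 0`. -/
theorem act_ne_zero_iff (S : SurfaceShadow HX G) (g : G) (a : HX) : g • a ≠ 0 ↔ a ≠ 0 :=
  (S.actAlgEquiv g).map_ne_zero_iff

/-! ### 2. Complex conjugation -/

/-- `bar 0 = 0`. -/
theorem bar_zero (S : SurfaceShadow HX G) : S.bar 0 = 0 := by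
  have h := S.bar_add 0 0
  rw [add_zero] at h
  have h2 : S.bar 0 + S.bar 0 = S.bar 0 + 0 := by rw [add_zero, ← h]
  exact add_left_cancel h2

/-- `bar (-a) = -bar a`. -/
theorem bar_neg (S : SurfaceShadow HX G) (a : HX) : S.bar (-a) = -S.bar a := by
  have h := S.bar_add a (-a)
  rw [add_neg_cancel, S.bar_zero] at h
  exact eq_neg_of_add_eq_zero_right h.symm

/-- `bar (a - b) = bar a - bar b`. -/
theorem bar_sub (S : SurfaceShadow HX G) (a b : HX) : S.bar (a - b) = S.bar a - S.bar b := by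
  rw [sub_eq_add_neg, S.bar_add, S.bar_neg, sub_eq_add_neg]

/-- Complex conjugation as a conjugate-linear (`starRingEnd ℂ`-semilinear) map. -/
def barSemilinear (S : SurfaceShadow HX G) : HX →ₛₗ[starRingEnd ℂ] HX where
  toFun := S.bar
  map_add' := S.bar_add
  map_smul' z a := S.bar_smul z a

/-- `barSemilinear a = bar a`. -/
@[simp] theorem barSemilinear_apply (S : SurfaceShadow HX G) (a : HX) : S.barSemilinear a = S.bar a := rfl

/-- Complex conjugation commutes with finite sums. -/
theorem bar_sum (S : SurfaceShadow HX G) {ι : Type*} (s : Finset ι) (f : ι → HX) :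
    S.bar (∑ i ∈ s, f i) = ∑ i ∈ s, S.bar (f i) :=
  map_sum S.barSemilinear f s

/-- Complex conjugation is injective (it is an involution). -/
theorem bar_injective (S : SurfaceShadow HX G) : Function.Injective S.bar := by
  intro a b h
  rw [← S.bar_bar a, h, S.bar_bar]

/-- `bar a = 0 ↔ a = 0`. -/
theorem bar_eq_zero_iff (S : SurfaceShadow HX G) (a : HX) : S.bar a = 0 ↔ a = 0 :=
  ⟨fun h => S.bar_injective (by rw [h, S.bar_zero]), fun h => by rw [h, S.bar_zero]⟩

/-- `bar 1 = 1` (from `bar_mul` and `bar_bar`). -/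
theorem bar_one (S : SurfaceShadow HX G) : S.bar 1 = 1 := by
  calc S.bar 1 = S.bar 1 * 1 := (mul_one _).symm
    _ = S.bar 1 * S.bar (S.bar 1) := by rw [S.bar_bar]
    _ = S.bar (1 * S.bar 1) := by rw [S.bar_mul]
    _ = S.bar (S.bar 1) := by rw [one_mul]
    _ = 1 := S.bar_bar 1

/-! ### 3. The `L²` pairing -/

/-- `L2 a b = ∫_X a ∧ b̄`, by definition. -/
theorem L2_def (S : SurfaceShadow HX G) (a b : HX) : S.L2 a b = S.intX (a * S.bar b) := rfl

/-- The pairing is additive in the first slot. -/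
theorem L2_add_left (S : SurfaceShadow HX G) (a b c : HX) : S.L2 (a + b) c = S.L2 a c + S.L2 b c := by
  simp only [L2_def, add_mul, map_add]

/-- The pairing is ℂ-linear in the first slot. -/
theorem L2_smul_left (S : SurfaceShadow HX G) (z : ℂ) (a b : HX) : S.L2 (z • a) b = z * S.L2 a b := by
  simp only [L2_def, smul_mul_assoc, map_smul, smul_eq_mul]

/-- The pairing is additive in the second slot. -/
theorem L2_add_right (S : SurfaceShadow HX G) (a b c : HX) : S.L2 a (b + c) = S.L2 a b + S.L2 a c := by
  simp only [L2_def, S.bar_add, mul_add, map_add]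

/-- The pairing is conjugate-linear in the second slot: `L2 a (z • b) = conj z * L2 a b`. -/
theorem L2_smul_right (S : SurfaceShadow HX G) (z : ℂ) (a b : HX) : S.L2 a (z • b) = (starRingEnd ℂ) z * S.L2 a b := by
  simp only [L2_def, S.bar_smul, mul_smul_comm, map_smul, smul_eq_mul]

/-- `L2 0 b = 0`. -/
theorem L2_zero_left (S : SurfaceShadow HX G) (b : HX) : S.L2 0 b = 0 := by simp [L2_def]

/-- `L2 a 0 = 0`. -/
theorem L2_zero_right (S : SurfaceShadow HX G) (a : HX) : S.L2 a 0 = 0 := by simp [L2_def, S.bar_zero]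

/-- `L2 (-a) b = -L2 a b`. -/
theorem L2_neg_left (S : SurfaceShadow HX G) (a b : HX) : S.L2 (-a) b = -S.L2 a b := by simp [L2_def]

/-- `L2 a (-b) = -L2 a b`. -/
theorem L2_neg_right (S : SurfaceShadow HX G) (a b : HX) : S.L2 a (-b) = -S.L2 a b := by simp [L2_def, S.bar_neg]

/-- The pairing commutes with finite sums in the first slot. -/
theorem L2_sum_left (S : SurfaceShadow HX G) {ι : Type*} (s : Finset ι) (f : ι → HX) (b : HX) :
    S.L2 (∑ i ∈ s, f i) b = ∑ i ∈ s, S.L2 (f i) b := by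
  simp only [L2_def, Finset.sum_mul, map_sum]

/-- The pairing commutes with finite sums in the second slot. -/
theorem L2_sum_right (S : SurfaceShadow HX G) {ι : Type*} (s : Finset ι) (a : HX) (f : ι → HX) :
    S.L2 a (∑ i ∈ s, f i) = ∑ i ∈ s, S.L2 a (f i) := by
  simp only [L2_def, S.bar_sum, Finset.mul_sum, map_sum]

/-- The `L²` pairing in its first slot, as a ℂ-linear functional. -/
def L2Left (S : SurfaceShadow HX G) (b : HX) : HX →ₗ[ℂ] ℂ :=
  S.intX.comp (LinearMap.mulRight ℂ (S.bar b))

/-- `L2Left b a = L2 a b`. -/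
@[simp] theorem L2Left_apply (S : SurfaceShadow HX G) (a b : HX) : S.L2Left b a = S.L2 a b := rfl

/-- The `L²` pairing in its second slot, as a conjugate-linear functional. -/
def L2Right (S : SurfaceShadow HX G) (a : HX) : HX →ₛₗ[starRingEnd ℂ] ℂ :=
  (S.intX.comp (LinearMap.mulLeft ℂ a)).comp S.barSemilinear

/-- `L2Right a b = L2 a b`. -/
@[simp] theorem L2Right_apply (S : SurfaceShadow HX G) (a b : HX) : S.L2Right a b = S.L2 a b := rfl

/-- Hecke invariance of the pairing: `⟨g • a, g • b⟩ = ⟨a, b⟩` (`act_mul`, `bar_act`, `intX_act`). -/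
theorem L2_act (S : SurfaceShadow HX G) (g : G) (a b : HX) : S.L2 (g • a) (g • b) = S.L2 a b := by
  rw [L2_def, S.bar_act, ← S.act_mul, S.intX_act, L2_def]

/-- Conjugate symmetry on holomorphic 2-forms: `⟨b, a⟩ = conj ⟨a, b⟩` (`comm_H20`, `intX_bar`, `bar_bar`). -/
theorem L2_conj_symm (S : SurfaceShadow HX G) {a b : HX} (ha : a ∈ S.H10 * S.H10) (hb : b ∈ S.H10 * S.H10) :
    S.L2 b a = (starRingEnd ℂ) (S.L2 a b) := by
  rw [L2_def, L2_def, ← S.intX_bar, S.bar_mul, S.bar_bar, S.comm_H20 b hb a ha]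

/-- Hodge–Riemann positivity: `0 < Re ⟨a, a⟩` for `0 ≠ a ∈ H^{1,0} ∧ H^{1,0}` (field `hr_pos`). -/
theorem L2_self_re_pos (S : SurfaceShadow HX G) {a : HX} (ha : a ∈ S.H10 * S.H10) (h : a ≠ 0) : 0 < (S.L2 a a).re :=
  S.hr_pos a ha h

/-- `⟨a, a⟩ ≠ 0` for `0 ≠ a ∈ H^{1,0} ∧ H^{1,0}`. -/
theorem L2_self_ne_zero (S : SurfaceShadow HX G) {a : HX} (ha : a ∈ S.H10 * S.H10) (h : a ≠ 0) : S.L2 a a ≠ 0 := by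
  intro h0
  have := S.hr_pos a ha h
  rw [← L2_def, h0] at this
  simp at this

/-- On `H^{1,0} ∧ H^{1,0}`, `⟨a, a⟩ = 0 ↔ a = 0`. -/
theorem L2_self_eq_zero_iff (S : SurfaceShadow HX G) {a : HX} (ha : a ∈ S.H10 * S.H10) : S.L2 a a = 0 ↔ a = 0 :=
  ⟨fun h => by_contra fun h0 => S.L2_self_ne_zero ha h0 h, fun h => by rw [h, L2_zero_left]⟩

/-- POSITIVITY, in the form the Gram / Petersson lines use: if the second form is a non-zero multiple of the
first, `b = c • a`, and `0 ≠ a ∈ H^{1,0} ∧ H^{1,0}`, then `⟨a, b⟩ ≠ 0`. -/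
theorem L2_ne_zero_of_eq_smul (S : SurfaceShadow HX G) {a b : HX} (ha : a ∈ S.H10 * S.H10) (h0 : a ≠ 0) {c : ℂ} (hc : c ≠ 0)
    (hb : b = c • a) : S.L2 a b ≠ 0 := by
  rw [hb, L2_smul_right]
  exact mul_ne_zero ((map_ne_zero (starRingEnd ℂ)).mpr hc) (S.L2_self_ne_zero ha h0)

/-- On `H^{1,0} ∧ H^{1,0}` the non-vanishing of the pairing is symmetric. -/
theorem L2_ne_zero_comm (S : SurfaceShadow HX G) {a b : HX} (ha : a ∈ S.H10 * S.H10) (hb : b ∈ S.H10 * S.H10) :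
    S.L2 a b ≠ 0 ↔ S.L2 b a ≠ 0 := by
  rw [S.L2_conj_symm ha hb]
  exact (map_ne_zero (starRingEnd ℂ)).symm


/-- The Hecke translates preserve `H^{1,0} ∧ H^{1,0}` (`act_H10`, `act_mul`, `act_add`, `act_smul`). -/
theorem H20_stable (S : SurfaceShadow HX G) (g : G) {a : HX} (ha : a ∈ S.H10 * S.H10) :
    g • a ∈ S.H10 * S.H10 := by
  refine Submodule.mul_induction_on ha ?_ ?_
  · intro x hx y hy
    rw [S.act_mul]
    exact Submodule.mul_mem_mul (S.act_H10 g x hx) (S.act_H10 g y hy)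
  · intro x y hx hy
    rw [S.act_add]
    exact Submodule.add_mem _ hx hy

/-- NON-DEGENERACY on holomorphic 2-forms: a form orthogonal to everything in `H^{1,0} ∧ H^{1,0}` (in
particular to itself) is zero. -/
theorem eq_zero_of_L2_eq_zero (S : SurfaceShadow HX G) {a : HX} (ha : a ∈ S.H10 * S.H10)
    (h : ∀ b ∈ S.H10 * S.H10, S.L2 a b = 0) : a = 0 :=
  (S.L2_self_eq_zero_iff ha).mp (h a ha)

/-- The `L²`-orthogonal complement of a set inside `H^{1,0} ∧ H^{1,0}`. -/
def orth (S : SurfaceShadow HX G) (U : Set HX) : Submodule ℂ HX where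
  carrier := {b | b ∈ S.H10 * S.H10 ∧ ∀ a ∈ U, S.L2 a b = 0}
  add_mem' := by
    rintro x y ⟨hx, hx'⟩ ⟨hy, hy'⟩
    exact ⟨Submodule.add_mem _ hx hy, fun a ha => by rw [S.L2_add_right, hx' a ha, hy' a ha, add_zero]⟩
  zero_mem' := ⟨Submodule.zero_mem _, fun a _ => S.L2_zero_right a⟩
  smul_mem' := by
    rintro c x ⟨hx, hx'⟩
    exact ⟨Submodule.smul_mem _ c hx, fun a ha => by rw [S.L2_smul_right, hx' a ha, mul_zero]⟩

/-- Membership in the orthogonal complement, unfolded. -/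
theorem mem_orth (S : SurfaceShadow HX G) {U : Set HX} {b : HX} :
    b ∈ S.orth U ↔ b ∈ S.H10 * S.H10 ∧ ∀ a ∈ U, S.L2 a b = 0 := Iff.rfl

/-- The orthogonal complement lies in `H^{1,0} ∧ H^{1,0}`. -/
theorem orth_le (S : SurfaceShadow HX G) (U : Set HX) : S.orth U ≤ S.H10 * S.H10 := fun _ hb => hb.1

/-- The orthogonal complement of a Hecke-stable set is Hecke-stable (`L2_act` + invertibility). -/
theorem heckeStable_orth (S : SurfaceShadow HX G) {U : Submodule ℂ HX} (hU : HeckeStable G U) :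
    HeckeStable G (S.orth U) := by
  rintro g b ⟨hb, hb'⟩
  refine ⟨S.H20_stable g hb, fun a ha => ?_⟩
  have h1 : a = g • (g⁻¹ • a) := (smul_inv_smul g a).symm
  rw [h1, S.L2_act]
  exact hb' _ (hU g⁻¹ a ha)

end SurfaceShadow

/-! ### 4. Linear functionals on spans (the tool behind the «pure tuple» lemma) -/

/-- A (semi)linear functional that is non-zero at some point of a span is non-zero at some generator. -/
theorem exists_ne_zero_of_mem_span {M : Type*} [AddCommGroup M] [Module ℂ M] {σ : ℂ →+* ℂ}
    (φ : M →ₛₗ[σ] ℂ) {s : Set M} {x : M} (hx : x ∈ Submodule.span ℂ s) (h : φ x ≠ 0) :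
    ∃ y ∈ s, φ y ≠ 0 := by
  by_contra hcon
  apply h
  have hzero : ∀ y ∈ s, φ y = 0 := fun y hy => by
    by_contra hne
    exact hcon ⟨y, hy, hne⟩
  have hle : Submodule.span ℂ s ≤ LinearMap.ker φ :=
    Submodule.span_le.mpr fun y hy => LinearMap.mem_ker.mpr (hzero y hy)
  exact LinearMap.mem_ker.mp (hle hx)

end

end Summit.Ventures.HodgeRepro2.Tier7
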